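import Mathlib
import Summits.Ventures.HodgeRepro2.Tier7.Target
import Summits.Ventures.HodgeRepro2.Tier7.Common.Shadow
import Summits.Ventures.HodgeRepro2.Tier7.Common.Hecke

/-!
# Tier7/Common/Datum — the lemma layer over the Target's `PeriodDatum` (t7-typer-1)

Cell pub-hodge-repro2, Tier 7 (README §11–§12), seat t7-typer-1 (sole filer of `Tier7/Common/**`).
Proof lane: everything below is PROVED from the fields of `PeriodDatum` / `SurfaceShadow` as frozen in
`Tier7/Target.lean`; no new carrier, no new field, no axiom, no `sorry`. Nothing here asserts the step.

CONTENT. (1) Memberships: every eigenvector `e i` is a holomorphic 1-form on `B` (`e_mem_h10`, from the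
eigenline fields and `s ∈ T 0 ∩ T 1`, `s̄ ∈ T 2 ∩ T 3`); the base theta lifts `thetaBase i = f_i^* e_i` and
their Hecke translates `theta g i` are non-zero holomorphic 1-forms on `X` lying in the summands `omega i`;
`fOmegaS g`, `fOmegaSbar g ∈ H^{1,0} ∧ H^{1,0}` (so `hr_pos`, `comm_H20`, `L2_conj_symm`, … apply to them).
(2) Hecke density for the theta lifts: `heckeSpan G (thetaBase i) = omega i` (from `omega_irred`).
(3) THE PURE-TUPLE LEMMA `exists_translates_of_pairing_ne_zero`: the pairing
`⟨a ∧ b, c ∧ d⟩` is linear in `a, b` and conjugate-linear in `c, d`; if it is non-zero for SOME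
`a ∈ span{g • θ(μ_0)}`, `b ∈ span{g • θ(μ_1)}`, `c ∈ span{g • θ(μ_2)}`, `d ∈ span{g • θ(μ_3)}` (equivalently,
by (2), for some `a ∈ omega 0`, …, `d ∈ omega 3`), then it is non-zero for a single tuple of Hecke
translates `g : Fin 4 → G` — i.e. the conclusion of `P_T7` for the datum. This is the reduction every
Hecke-density line uses («multilinearity ⇒ pure tuple»); it carries no mathematics beyond linear algebra.

§8(d): uses an L-value-free non-vanishing device: NO (general lemmas over the carriers).
-/

namespace Summit.Ventures.HodgeRepro2.Tier7

open Summit.Ventures.HodgeRepro2.T6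

noncomputable section

namespace PeriodDatum

variable {K : Type} [Field K] [NumberField K] {E' : Type} [Field E'] [NumberField E']
  {V : Type} [AddCommGroup V] [Module E' V] {HX : Type} [Ring HX] [Algebra ℂ HX]
  {G : Type} [Group G] [MulAction G HX]

/-! ### 1. Memberships -/

/-- `ℓ_{i,σ} ≤ H^{1,0}(B)` when `σ ∈ T i`. -/
theorem eigenLine_le_h10 (F : Face K) (i : Fin 4) {σ : K →+* ℂ} (hi : σ ∈ F.T i) :
    eigenLine K i σ ≤ F.h10 :=
  le_iSup_of_le i (le_iSup₂_of_le σ hi le_rfl)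

/-- Every eigenvector `e i` is a holomorphic 1-form on the corner product `B`. -/
theorem e_mem_h10 (D : PeriodDatum K E' V HX G) (i : Fin 4) : D.e i ∈ D.F.h10 := by
  fin_cases i
  · exact eigenLine_le_h10 D.F 0 D.hs0 D.e0_mem
  · exact eigenLine_le_h10 D.F 1 D.hs1 D.e1_mem
  · exact eigenLine_le_h10 D.F 2 D.hs2 D.e2_mem
  · exact eigenLine_le_h10 D.F 3 D.hs3 D.e3_mem

/-- The base theta lift `θ(μ_i) = f_i^* e_i` (before any Hecke translate). -/
def thetaBase (D : PeriodDatum K E' V HX G) (i : Fin 4) : HX := D.alb (D.e i)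

/-- `theta g i = g i • thetaBase i`, by definition. -/
theorem theta_eq (D : PeriodDatum K E' V HX G) (g : Fin 4 → G) (i : Fin 4) :
    D.theta g i = g i • D.thetaBase i := rfl

/-- `θ(μ_i)` is a holomorphic 1-form on `X` (`alb_h10`). -/
theorem thetaBase_mem_H10 (D : PeriodDatum K E' V HX G) (i : Fin 4) : D.thetaBase i ∈ D.S.H10 :=
  D.alb_h10 _ (D.e_mem_h10 i)

/-- `θ(μ_i)` lies in its theta-lift summand `omega i` (`theta_mem`). -/
theorem thetaBase_mem_omega (D : PeriodDatum K E' V HX G) (i : Fin 4) : D.thetaBase i ∈ D.omega i :=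
  D.theta_mem i

/-- `f^*` injective and `e i ≠ 0` give `θ(μ_i) ≠ 0`. -/
theorem thetaBase_ne_zero (D : PeriodDatum K E' V HX G) (i : Fin 4) : D.thetaBase i ≠ 0 := by
  intro h
  apply D.e_ne i
  apply D.alb_inj
  rw [map_zero]
  exact h

/-- Every Hecke translate of `θ(μ_i)` is a holomorphic 1-form (`act_H10`). -/
theorem theta_mem_H10 (D : PeriodDatum K E' V HX G) (g : Fin 4 → G) (i : Fin 4) :
    D.theta g i ∈ D.S.H10 :=
  D.S.act_H10 (g i) _ (D.thetaBase_mem_H10 i)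

/-- Every Hecke translate of `θ(μ_i)` lies in `omega i` (Hecke-stability of the summand). -/
theorem theta_mem_omega (D : PeriodDatum K E' V HX G) (g : Fin 4 → G) (i : Fin 4) :
    D.theta g i ∈ D.omega i :=
  (D.omega_irred i).2.1 (g i) _ (D.thetaBase_mem_omega i)

/-- Every Hecke translate of `θ(μ_i)` is non-zero. -/
theorem theta_ne_zero (D : PeriodDatum K E' V HX G) (g : Fin 4 → G) (i : Fin 4) : D.theta g i ≠ 0 :=
  (D.S.act_ne_zero_iff (g i) _).mpr (D.thetaBase_ne_zero i)

/-- `f^*Ω_s = θ(μ_0) ∧ θ(μ_1)` is a holomorphic 2-form: it lies in `H^{1,0} ∧ H^{1,0}`. -/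
theorem fOmegaS_mem (D : PeriodDatum K E' V HX G) (g : Fin 4 → G) :
    D.fOmegaS g ∈ D.S.H10 * D.S.H10 :=
  Submodule.mul_mem_mul (D.theta_mem_H10 g 0) (D.theta_mem_H10 g 1)

/-- `f^*Ω_{s̄} = θ(μ_2) ∧ θ(μ_3)` is a holomorphic 2-form. -/
theorem fOmegaSbar_mem (D : PeriodDatum K E' V HX G) (g : Fin 4 → G) :
    D.fOmegaSbar g ∈ D.S.H10 * D.S.H10 :=
  Submodule.mul_mem_mul (D.theta_mem_H10 g 2) (D.theta_mem_H10 g 3)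

/-- The pairing of the target is conjugate-symmetric: `⟨f^*Ω_{s̄}, f^*Ω_s⟩ = conj ⟨f^*Ω_s, f^*Ω_{s̄}⟩`. -/
theorem L2_fOmega_conj_symm (D : PeriodDatum K E' V HX G) (g : Fin 4 → G) :
    D.S.L2 (D.fOmegaSbar g) (D.fOmegaS g) = (starRingEnd ℂ) (D.S.L2 (D.fOmegaS g) (D.fOmegaSbar g)) :=
  D.S.L2_conj_symm (D.fOmegaS_mem g) (D.fOmegaSbar_mem g)


/-- A common Hecke translate of both wedges: `g • f^*Ω_s(g') = f^*Ω_s(g * g')` (`act_mul`, `mul_smul`). -/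
theorem smul_fOmegaS (D : PeriodDatum K E' V HX G) (g : G) (g' : Fin 4 → G) :
    g • D.fOmegaS g' = D.fOmegaS (fun i => g * g' i) := by
  simp only [fOmegaS, theta, D.S.act_mul, smul_smul]

/-- A common Hecke translate of both factors of `f^*Ω_{s̄}`: `g • f^*Ω_{s̄}(g') = f^*Ω_{s̄}(g * g')`. -/
theorem smul_fOmegaSbar (D : PeriodDatum K E' V HX G) (g : G) (g' : Fin 4 → G) :
    g • D.fOmegaSbar g' = D.fOmegaSbar (fun i => g * g' i) := by
  simp only [fOmegaSbar, theta, D.S.act_mul, smul_smul]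

/-- The pairing is invariant under a common Hecke translate of all four forms. -/
theorem L2_fOmega_mul_left (D : PeriodDatum K E' V HX G) (g : G) (g' : Fin 4 → G) :
    D.S.L2 (D.fOmegaS (fun i => g * g' i)) (D.fOmegaSbar (fun i => g * g' i)) =
      D.S.L2 (D.fOmegaS g') (D.fOmegaSbar g') := by
  rw [← D.smul_fOmegaS, ← D.smul_fOmegaSbar, D.S.L2_act]

/-! ### 2. Hecke density for the theta lifts -/

/-- The Hecke translates of `θ(μ_i)` span the whole summand `omega i` (`omega_irred`). -/
theorem heckeSpan_thetaBase (D : PeriodDatum K E' V HX G) (i : Fin 4) :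
    heckeSpan G (D.thetaBase i) = D.omega i :=
  heckeSpan_eq_of_irred D.S (D.omega_irred i) (D.thetaBase_mem_omega i) (D.thetaBase_ne_zero i)

/-- Every vector of `omega i` is a ℂ-linear combination of Hecke translates of `θ(μ_i)`. -/
theorem mem_heckeSpan_thetaBase_of_mem_omega (D : PeriodDatum K E' V HX G) {i : Fin 4} {w : HX}
    (hw : w ∈ D.omega i) : w ∈ heckeSpan G (D.thetaBase i) := by
  rw [D.heckeSpan_thetaBase i]; exact hw

/-! ### 3. The pure-tuple lemma -/

/-- The conclusion of `P_T7` for the datum `D`: some tuple of Hecke translates has a non-zero pairing. -/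
def Concl (D : PeriodDatum K E' V HX G) : Prop :=
  ∃ g : Fin 4 → G, D.S.L2 (D.fOmegaS g) (D.fOmegaSbar g) ≠ 0

/-- THE PURE-TUPLE LEMMA. If `⟨a ∧ b, c ∧ d⟩ ≠ 0` for some `a, b, c, d` in the Hecke spans of
`θ(μ_0), θ(μ_1), θ(μ_2), θ(μ_3)`, then some single tuple of Hecke translates `g` has
`⟨f^*Ω_s, f^*Ω_{s̄}⟩ ≠ 0` (multilinearity of the pairing: linear in `a, b`, conjugate-linear in `c, d`). -/
theorem exists_translates_of_pairing_ne_zero (D : PeriodDatum K E' V HX G) {a b c d : HX}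
    (ha : a ∈ heckeSpan G (D.thetaBase 0)) (hb : b ∈ heckeSpan G (D.thetaBase 1))
    (hc : c ∈ heckeSpan G (D.thetaBase 2)) (hd : d ∈ heckeSpan G (D.thetaBase 3))
    (h : D.S.L2 (a * b) (c * d) ≠ 0) : D.Concl := by
  -- slot 1: `x ↦ ⟨x ∧ b, c ∧ d⟩` is ℂ-linear
  obtain ⟨_, ⟨g₀, rfl⟩, h₀⟩ := exists_ne_zero_of_mem_span
    ((D.S.L2Left (c * d)).comp (LinearMap.mulRight ℂ b)) ha h
  -- slot 2: `x ↦ ⟨(g₀ • θ₀) ∧ x, c ∧ d⟩` is ℂ-linear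
  obtain ⟨_, ⟨g₁, rfl⟩, h₁⟩ := exists_ne_zero_of_mem_span
    ((D.S.L2Left (c * d)).comp (LinearMap.mulLeft ℂ (g₀ • D.thetaBase 0))) hb h₀
  -- slot 3: `x ↦ ⟨(g₀ • θ₀) ∧ (g₁ • θ₁), x ∧ d⟩` is conjugate-linear
  obtain ⟨_, ⟨g₂, rfl⟩, h₂⟩ := exists_ne_zero_of_mem_span
    ((D.S.L2Right (g₀ • D.thetaBase 0 * g₁ • D.thetaBase 1)).comp (LinearMap.mulRight ℂ d)) hc h₁
  -- slot 4: `x ↦ ⟨(g₀ • θ₀) ∧ (g₁ • θ₁), (g₂ • θ₂) ∧ x⟩` is conjugate-linear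
  obtain ⟨_, ⟨g₃, rfl⟩, h₃⟩ := exists_ne_zero_of_mem_span
    ((D.S.L2Right (g₀ • D.thetaBase 0 * g₁ • D.thetaBase 1)).comp
      (LinearMap.mulLeft ℂ (g₂ • D.thetaBase 2))) hd h₂
  exact ⟨![g₀, g₁, g₂, g₃], h₃⟩

/-- The pure-tuple lemma with the spans replaced by the summands `omega i` (Hecke density). -/
theorem exists_translates_of_pairing_ne_zero' (D : PeriodDatum K E' V HX G) {a b c d : HX}
    (ha : a ∈ D.omega 0) (hb : b ∈ D.omega 1) (hc : c ∈ D.omega 2) (hd : d ∈ D.omega 3)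
    (h : D.S.L2 (a * b) (c * d) ≠ 0) : D.Concl :=
  D.exists_translates_of_pairing_ne_zero (D.mem_heckeSpan_thetaBase_of_mem_omega ha)
    (D.mem_heckeSpan_thetaBase_of_mem_omega hb) (D.mem_heckeSpan_thetaBase_of_mem_omega hc)
    (D.mem_heckeSpan_thetaBase_of_mem_omega hd) h


/-- The quadrilinear form of the target: `Λ(a, b, c, d) = ⟨a ∧ b, c ∧ d⟩_{L²(X)}`. -/
def Lambda (D : PeriodDatum K E' V HX G) (a b c d : HX) : ℂ := D.S.L2 (a * b) (c * d)

/-- `Λ` on the translated theta lifts is the pairing of the target. -/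
theorem Lambda_theta (D : PeriodDatum K E' V HX G) (g : Fin 4 → G) :
    D.Lambda (D.theta g 0) (D.theta g 1) (D.theta g 2) (D.theta g 3) =
      D.S.L2 (D.fOmegaS g) (D.fOmegaSbar g) := rfl

/-- THE REDUCTION OF RECORD: over the datum `D`, the conclusion of `P_T7` is EQUIVALENT to «the form
`Λ` is not identically zero on `omega 0 × omega 1 × omega 2 × omega 3`». -/
theorem concl_iff_exists_omega (D : PeriodDatum K E' V HX G) :
    D.Concl ↔ ∃ a ∈ D.omega 0, ∃ b ∈ D.omega 1, ∃ c ∈ D.omega 2, ∃ d ∈ D.omega 3,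
      D.Lambda a b c d ≠ 0 := by
  constructor
  · rintro ⟨g, hg⟩
    exact ⟨_, D.theta_mem_omega g 0, _, D.theta_mem_omega g 1, _, D.theta_mem_omega g 2, _,
      D.theta_mem_omega g 3, hg⟩
  · rintro ⟨a, ha, b, hb, c, hc, d, hd, h⟩
    exact D.exists_translates_of_pairing_ne_zero' ha hb hc hd h

end PeriodDatum

/-- `P_T7` is the conjunction of `D.Concl` over every datum `D`. -/
theorem P_T7_iff : P_T7 ↔ ∀ (K : Type) [Field K] [NumberField K] (E' : Type) [Field E'] [NumberField E']
    (V : Type) [AddCommGroup V] [Module E' V] (HX : Type) [Ring HX] [Algebra ℂ HX]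
    (G : Type) [Group G] [MulAction G HX] (D : PeriodDatum K E' V HX G), D.Concl :=
  Iff.rfl

end

end Summit.Ventures.HodgeRepro2.Tier7
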